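/-
Copyright: statement-level skeleton of a published paper (lit-balaban cell, Phase-2 proof seat p19, gen 5). No claims beyond
what the kernel checks below.
-/
import Mathlib
import Literature.MathematicalPhysics.QuantumFieldTheory.Balaban1983to89.B3AmpIBPBounds

/-!
# B3 — T. Bałaban, *(Higgs)₂,₃ quantum fields in a finite volume. III. Renormalization*, CMP **88** (1983) 411–445
[Balaban1983Higgs3] — Sect. 2, pp. 425–426: the IBP-ready localized graph amplitudes AT THE PRINT'S STRENGTH — one
derivative leg per vertex, the derivative budget (2.10) demanded only for at most one difference per propagator argument

statement-level skeleton of published theorems with citation tags; proofs where landed; nothing here is a claim about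
the Yang–Mills mass gap

PDF held: `paper:balaban1983-higgs-2-3-quantum-fields-finite-volume` (journal page = PDF page + 410); pp. 424–426 [PDF 14–16]
read on the materialised text (`lit read … --pages 12-18`): the vertices (1.8)/(1.9) p. 413, the integration by parts
(2.8)/(2.9) p. 425 and the sentence after (2.10) p. 426.

Part of the Phase-2 work on SKELETON rows **B3.Prop2.1 / B3.Prop2.2 / B3.Eq2.10** (unit `lit-balaban-p19` gen 5, HOME
`run/shared/lean/pub/lit-balaban/`): files `B3AmpIBPSingle` (this file) → `B3Prop21Except24Single` → `B3IBPZeroBoxKernels` →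
`B3IBPZeroBox` — Proposition 2.1 WITH the (2.4) exception, the IBP-readiness hypotheses of gen 4's `B3Prop21Except24`
DISCHARGED for the zero-field box line class.  Sub-namespace `…Balaban1983to89.B3Ineq213` (gen 3/4), new names only; no
existing declaration is modified.

WHAT IS REPRODUCED.  p. 425 [PDF 15], (2.8): *"For a vertex in (2.4) we have −e(L^kε)Σ_{b⊂T_η}η^d[(D^η_B̃φ′)(b)·qφ′(b₋)]
g(b₋)A′_b = … = −e(L^kε)Σ_x η^d[φ′(x)·qφ′(x)]g(x)(∂^{η∗}A′)(x) − e(L^kε)Σ_x η^d[φ′(x)·qφ′(x)]Σ_μ(∂^{η∗}_μ g)(x)A′_μ(x−ηe_μ) −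
e(L^kε)Σ_x η^d Σ_μ[φ′(x)·q(D^η_{B̃,μ}φ′)(x)]g(x−ηe_μ)A′_μ(x−ηe_μ)"* — the ONE derivative leg `(D^η_B̃φ′)(b)` of the vertex (1.8)
p. 413 is moved onto the other factors at the vertex, each of which was undifferentiated there; p. 426 [PDF 16]: *"if the
propagator is differentiated, then for each differentiation, there is an additional factor (L^jη)^{−1} on the right side"*.
Hence every propagator argument carries AT MOST ONE difference after (2.8) (its own vertex's derivative leg, or the moved
one), and only bounds of the value, of one difference in either argument and of the mixed difference are ever used — the
estimates Propositions I.2.1/I.2.3 state.  Gen 4's class `B3AmpIBPBounds.IBPAmp` demanded the budget `KdX_le`/`KdY_le`/`KdXY_le`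
for EVERY line, i.e. also a second difference in an argument already differentiated; KERNEL-CHECKED HERE is the class
**`IBPAmp₁ G`** with (i) **`single`**: a vertex has at most one derivative leg (`l ≠ l′ → 1 ≤ diffOn v l → diffOn v l′ = 0`, as
for all of (1.6)–(1.15)), (ii) the budget demanded only where the print needs it: `KdX_le` for lines undifferentiated at their
first endpoint (`diffOn (src l) l = 0`), `KdY_le` at the second, `KdXY_le` at both — and the THEOREM that every term `G′∗_c` of
`B3AmpIBPAll` (sites `S ⊆ sites G`, choice `c`) is again an amplitude of the class `Amp` over gen 4's moved count datum
`moveCounts G S c` (**`IBPAmp₁.term`**, kernels obeying (2.10) with the moved dimensions, `term_K_le`), with `E(G′(j)) = Σ_c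
E_{term c}(j)` (`E_eq_sum_terms`), `pref(term c) ≤ cD^m·pref` (`term_pref_le`), `Π C(term) = (Π C)(1+e^{δ₁})^{2m}`
(`term_prod_C`) — the same conclusions as gen 4's `IBPAmp.term`, from the weaker readiness: a line hit in its first variable
(`xcode = 2`) sits at a site vertex whose derivative leg is the site line, so by `single` it was undifferentiated there
(`diffOn_src_eq_zero_of_xcode`).  Gen 4's class maps into this one given `single` (`IBPAmp.toSingle`).
-/

open Finset

namespace Literature.MathematicalPhysics.QuantumFieldTheory.Balaban1983to89.B3Ineq213

open B3Ineq215

/-! ## Conditional derivative budgets -/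

section Budget

variable {V : Type} [Fintype V] [DecidableEq V] {m : ℕ} {M : Model V m} {k : ℕ}

/-- **The derivative budget of a kernel, demanded conditionally**: (2.10) for the kernel; for its difference quotient in the
first variable IF `px`, in the second IF `py`, in both IF both — *"for each differentiation, there is an additional factor
(L^jη)^{−1}"* applied to the configurations (2.8) produces. [cite: Balaban1983Higgs3, (2.10) p.426] -/
structure KBudgetC (M : Model V m) (k : ℕ) (C e : ℝ) (px py : Prop) (F : Ker M.d) : Prop where
  le0 : KBd M k C e F
  leX : px → ∀ μ, KBd M k C (e - 1) (dK ((M.L : ℝ) ^ k) μ true false F)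
  leY : py → ∀ ν, KBd M k C (e - 1) (dK ((M.L : ℝ) ^ k) ν false true F)
  leXY : px → py → ∀ μ ν, KBd M k C (e - 2) (dK ((M.L : ℝ) ^ k) μ true false (dK ((M.L : ℝ) ^ k) ν false true F))

/-- An unconditional budget is a conditional one. [cite: Balaban1983Higgs3, (2.10) p.426] -/
theorem KBudget.toC {C e : ℝ} {F : Ker M.d} (h : KBudget M k C e F) (px py : Prop) : KBudgetC M k C e px py F :=
  ⟨h.le0, fun _ μ => h.leX μ, fun _ ν => h.leY ν, fun _ _ μ ν => h.leXY μ ν⟩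

/-- **The kernels of `G′∗`, conditional form**: the operations of the two variables cost one `(L^jη)^{−1}` per differentiation and
at most `(1 + e^{2δ₀})²` in the constant — provided the variable that IS differentiated (code `2`) has its budget.
[cite: Balaban1983Higgs3, (2.10) p.426] -/
theorem KBudgetC.apCode_bound {C e : ℝ} {px py : Prop} {F : Ker M.d} (h : KBudgetC M k C e px py F) (hC : 0 ≤ C)
    {nx ny : ℕ} (hx : nx ≤ 2) (hy : ny ≤ 2) (hpx : nx = 2 → px) (hpy : ny = 2 → py) (μ ν : Fin M.d) :
    KBd M k (C * (1 + Esh M) ^ 2) (e - ((nd nx + nd ny : ℕ) : ℝ))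
      (apCode nx ((M.L : ℝ) ^ k) μ true false (apCode ny ((M.L : ℝ) ^ k) ν false true F)) := by
  have hE := one_le_Esh M
  have hE0 : 0 ≤ Esh M := le_trans zero_le_one hE
  have hsq : (1 + Esh M) ^ 2 = 1 + Esh M + Esh M + Esh M * Esh M := by ring
  have hCE : C * Esh M ≤ C * (1 + Esh M) ^ 2 := mul_le_mul_of_nonneg_left (by rw [hsq]; nlinarith) hC
  have hCEE : C * Esh M * Esh M ≤ C * (1 + Esh M) ^ 2 := by
    rw [mul_assoc]; exact mul_le_mul_of_nonneg_left (by rw [hsq]; nlinarith) hC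
  have hC1 : C ≤ C * (1 + Esh M) ^ 2 := le_mul_of_one_le_right hC (one_le_pow₀ (by linarith))
  interval_cases nx <;> interval_cases ny
  · simp only [apCode_zero]
    exact (h.le0.mono hC1).of_eq (by norm_num [nd])
  · simp only [apCode_zero, apCode_one]
    exact ((h.le0.shY hC ν).mono hCE).of_eq (by norm_num [nd])
  · simp only [apCode_zero, apCode_two]
    exact ((h.leY (hpy rfl) ν).mono hC1).of_eq (by norm_num [nd])
  · simp only [apCode_zero, apCode_one]
    exact ((h.le0.shX hC μ).mono hCE).of_eq (by norm_num [nd])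
  · simp only [apCode_one]
    rw [shK_tf_shK_ft]
    exact (((h.le0.shX hC μ).shY (mul_nonneg hC hE0) ν).mono hCEE).of_eq (by norm_num [nd])
  · simp only [apCode_one, apCode_two]
    exact (((h.leY (hpy rfl) ν).shX hC μ).mono hCE).of_eq (by norm_num [nd])
  · simp only [apCode_zero, apCode_two]
    exact ((h.leX (hpx rfl) μ).mono hC1).of_eq (by norm_num [nd])
  · simp only [apCode_one, apCode_two]
    rw [dK_tf_shK_ft]
    exact (((h.leX (hpx rfl) μ).shY hC ν).mono hCE).of_eq (by norm_num [nd])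
  · simp only [apCode_two]
    exact ((h.leXY (hpx rfl) (hpy rfl) μ ν).mono hC1).of_eq (by norm_num [nd])

/-- **The kernel of a loop at a site vertex**, conditional form (both variables operated on jointly; a differentiated loop needs
the budget of both its variables). [cite: Balaban1983Higgs3, (2.10) p.426] -/
theorem KBudgetC.apCode_bound_loop {C e : ℝ} {px py : Prop} {F : Ker M.d} (h : KBudgetC M k C e px py F) (hC : 0 ≤ C)
    {nx : ℕ} (hx : nx ≤ 2) (hpx : nx = 2 → px) (hpy : nx = 2 → py) (μ : Fin M.d) :
    KBd M k (C * (1 + Esh M) ^ 2) (e - ((nd nx : ℕ) : ℝ)) (apCode nx ((M.L : ℝ) ^ k) μ true true F) := by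
  have hE := one_le_Esh M
  have hE0 : 0 ≤ Esh M := le_trans zero_le_one hE
  have hsq : (1 + Esh M) ^ 2 = 1 + Esh M + Esh M + Esh M * Esh M := by ring
  have hCE : C * Esh M ≤ C * (1 + Esh M) ^ 2 := mul_le_mul_of_nonneg_left (by rw [hsq]; nlinarith) hC
  have hC1 : C ≤ C * (1 + Esh M) ^ 2 := le_mul_of_one_le_right hC (one_le_pow₀ (by linarith))
  have hC1E : C + C * Esh M ≤ C * (1 + Esh M) ^ 2 := by
    rw [show C + C * Esh M = C * (1 + Esh M) by ring]
    exact mul_le_mul_of_nonneg_left (by rw [hsq]; nlinarith) hC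
  interval_cases nx
  · simp only [apCode_zero]
    exact (h.le0.mono hC1).of_eq (by norm_num [nd])
  · simp only [apCode_one]
    exact ((h.le0.shXY hC μ).mono hCE).of_eq (by norm_num [nd])
  · simp only [apCode_two]
    rw [dK_tt_eq]
    exact (((h.leX (hpx rfl) μ).add ((h.leY (hpy rfl) μ).shX hC μ)).mono hC1E).of_eq (by norm_num [nd])

end Budget

/-! ## The class of IBP-ready amplitudes at the print's strength -/

section Ready

variable {V : Type} [Fintype V] [DecidableEq V] {m : ℕ}

/-- **An IBP-READY localized lattice graph amplitude, print's strength** over the count datum `G`: an amplitude of the class `Amp`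
with a bond direction per vertex; every vertex has AT MOST ONE derivative leg (`single` — the vertices (1.6)–(1.15)); for every
differentiated line `l` with two endpoints (`s(l) ≠ t(l)`, the derivative leg of `s(l)` on `l`) the undifferentiated kernel `K♭_l`,
`K_l = ∂⁺_{dir s(l)} K♭_l` in the first variable (mesh `η = L^{−k}`), obeying (2.10) with the dimension `a_l + 1`, and the vertex
function at `s(l)` vanishing on the `dir s(l)`-faces of `□(s(l))` with `|∂⁻ u_{s(l)}| ≤ cD ×` the vertex bound; and the derivative
budget (2.10) of a kernel in a variable ONLY IF the line is undifferentiated at that endpoint (where (2.8) can put a difference).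
[cite: Balaban1983Higgs3, (2.8) p.425] -/
structure IBPAmp₁ (G : Counts V m) extends Amp G.toModel where
  /-- the bond direction of the derivative leg at each vertex -/
  dir : V → Fin G.toModel.d
  /-- the undifferentiated kernels `K♭_l` -/
  Kb : Fin m → Ker G.toModel.d
  /-- the constant of the differentiated vertex bound -/
  cD : ℝ
  one_le_cD : 1 ≤ cD
  /-- at most one derivative leg per vertex -/
  single : ∀ (v : V) (l l' : Fin m), l ≠ l' → 1 ≤ G.diffOn v l → G.diffOn v l' = 0
  /-- `K_l = ∂⁺_{dir s(l)} K♭_l` in the first variable, on every differentiated line with two endpoints -/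
  K_eq : ∀ l, G.src l ≠ G.tgt l → 1 ≤ G.diffOn (G.src l) l → ∀ t x y,
    K l t x y = fdiffQ ((G.toModel.L : ℝ) ^ k) (dir (G.src l)) (fun x' => Kb l t x' y) x
  /-- (2.10) for `K♭_l` with the dimension `a_l + 1` -/
  Kb_le : ∀ l, G.src l ≠ G.tgt l → 1 ≤ G.diffOn (G.src l) l → KBd G.toModel k (C l) (G.toModel.a l + 1) (Kb l)
  /-- the vertex function at `s(l)` vanishes on the two `dir s(l)`-faces of its cube -/
  u_face : ∀ l, G.src l ≠ G.tgt l → 1 ≤ G.diffOn (G.src l) l →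
    FaceVanishing G.toModel.L (⟨k, box (G.src l)⟩ : Cube G.toModel.d) (dir (G.src l)) (u (G.src l))
  /-- the differentiated vertex bound -/
  du_le : ∀ l, G.src l ≠ G.tgt l → 1 ≤ G.diffOn (G.src l) l → ∀ x,
    |bdiffQ ((G.toModel.L : ℝ) ^ k) (dir (G.src l)) (u (G.src l)) x|
      ≤ cD * (eRun ^ dv (G.src l) * lamRun ^ ds (G.src l) * NPhi (G.src l) * NA (G.src l)
        * (((G.toModel.L : ℝ) ^ k)⁻¹) ^ G.toModel.e (G.src l))
  /-- (2.10) with one more difference quotient in the first variable — for lines undifferentiated at their first endpoint -/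
  KdX_le : ∀ l μ, G.diffOn (G.src l) l = 0 →
    KBd G.toModel k (C l) (G.toModel.a l - 1) (dK ((G.toModel.L : ℝ) ^ k) μ true false (K l))
  /-- (2.10) with one more difference quotient in the second variable — for lines undifferentiated at their second endpoint -/
  KdY_le : ∀ l ν, G.diffOn (G.tgt l) l = 0 →
    KBd G.toModel k (C l) (G.toModel.a l - 1) (dK ((G.toModel.L : ℝ) ^ k) ν false true (K l))
  /-- (2.10) with one more difference quotient in each variable — for lines undifferentiated at both endpoints -/
  KdXY_le : ∀ l μ ν, G.diffOn (G.src l) l = 0 → G.diffOn (G.tgt l) l = 0 → KBd G.toModel k (C l) (G.toModel.a l - 2)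
    (dK ((G.toModel.L : ℝ) ^ k) μ true false (dK ((G.toModel.L : ℝ) ^ k) ν false true (K l)))

/-- Gen 4's (stronger) readiness implies the print-strength readiness, given one derivative leg per vertex.
[cite: Balaban1983Higgs3, (2.8) p.425] -/
noncomputable def IBPAmp.toSingle {G : Counts V m} (A : IBPAmp G)
    (hs : ∀ (v : V) (l l' : Fin m), l ≠ l' → 1 ≤ G.diffOn v l → G.diffOn v l' = 0) : IBPAmp₁ G where
  toAmp := A.toAmp
  dir := A.dir
  Kb := A.Kb
  cD := A.cD
  one_le_cD := A.one_le_cD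
  single := hs
  K_eq := A.K_eq
  Kb_le := A.Kb_le
  u_face := A.u_face
  du_le := A.du_le
  KdX_le := fun l μ _ => A.KdX_le l μ
  KdY_le := fun l ν _ => A.KdY_le l ν
  KdXY_le := fun l μ ν _ _ => A.KdXY_le l μ ν

namespace IBPAmp₁

variable {G : Counts V m}

/-- The conditional derivative budget of each kernel. [cite: Balaban1983Higgs3, (2.10) p.426] -/
theorem budgetC (A : IBPAmp₁ G) (l : Fin m) : KBudgetC G.toModel A.k (A.C l) (G.toModel.a l)
    (G.diffOn (G.src l) l = 0) (G.diffOn (G.tgt l) l = 0) (A.K l) :=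
  ⟨A.K_le l, fun h μ => A.KdX_le l μ h, fun h ν => A.KdY_le l ν h, fun hx hy μ ν => A.KdXY_le l μ ν hx hy⟩

/-! ## Where (2.8) puts a difference, the line was undifferentiated -/

variable {S : Finset (Fin m)} {c : Fin m → Option (Fin m)}

/-- **A line hit in its first variable was undifferentiated at its first endpoint**: the hit comes from a site line `l ≠ q` at
`s(q)` carrying the derivative leg of that vertex, and a vertex has one derivative leg. [cite: Balaban1983Higgs3, (2.8) p.425] -/
theorem diffOn_src_eq_zero_of_xcode (A : IBPAmp₁ G) (hS : S ⊆ sites G) {q : Fin m} (hx : xcode G.src S c q = 2) :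
    G.diffOn (G.src q) q = 0 := by
  obtain ⟨l, hl, hlq, hsrc, -⟩ := (xcode_eq_two_iff G S c q).1 hx
  have h1 : 1 ≤ G.diffOn (G.src l) l := (mem_sites.1 (hS hl)).2.1
  rw [← hsrc]
  exact A.single (G.src l) l q hlq h1

/-- **A line hit in its second variable was undifferentiated at its second endpoint.** [cite: Balaban1983Higgs3, (2.8) p.425] -/
theorem diffOn_tgt_eq_zero_of_ycode (A : IBPAmp₁ G) (hS : S ⊆ sites G) {q : Fin m} (hy : ycode G.src G.tgt S c q = 2) :
    G.diffOn (G.tgt q) q = 0 := by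
  obtain ⟨l, hl, hlq, hsrc, -⟩ := (ycode_eq_two_iff G S c q).1 hy
  have h1 : 1 ≤ G.diffOn (G.src l) l := (mem_sites.1 (hS hl)).2.1
  rw [← hsrc]
  exact A.single (G.src l) l q hlq h1

/-! ## The terms `G′∗_c` are amplitudes of the class `Amp` -/

/-- The vertex-field norms of the term: a factor `cD` where the vertex function was differentiated. [cite: Balaban1983Higgs3, (2.9) p.425] -/
noncomputable def NAc (A : IBPAmp₁ G) (S : Finset (Fin m)) (c : Fin m → Option (Fin m)) (v : V) : ℝ :=
  if (∃ l ∈ S, G.src l = v ∧ c l = none) then A.cD * A.NA v else A.NA v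

/-- **The kernels of the term `c` obey (2.10) with the moved dimensions** and the constants `C_l (1 + e^{2δ₀})²` — from the
print-strength budget. [cite: Balaban1983Higgs3, (2.10) p.426] -/
theorem term_K_le (A : IBPAmp₁ G) (hS : S ⊆ sites G) (hc : c ∈ choices G.src G.tgt S) (q : Fin m) :
    KBd G.toModel A.k (A.C q * (1 + Esh G.toModel) ^ 2) ((moveCounts G S c).toModel.a q)
      (allK G.src G.tgt A.dir ((G.toModel.L : ℝ) ^ A.k) A.Kb S c A.K q) := by
  have hS1 : ∀ l ∈ S, 1 ≤ G.diffOn (G.src l) l := fun l hl => (mem_sites.1 (hS hl)).2.1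
  have hE := one_le_Esh G.toModel
  have hCq : 0 ≤ A.C q := A.C_nonneg q
  have hC1 : A.C q ≤ A.C q * (1 + Esh G.toModel) ^ 2 :=
    le_mul_of_one_le_right hCq (one_le_pow₀ (by linarith))
  rw [toModel_a_moveCounts G hS1 c q]
  by_cases hq : q ∈ S
  · -- a site line: `K♭`, dimension `a + 1`
    have hsite := mem_sites.1 (hS hq)
    rw [if_pos hq, IBPAmp.nHit_of_mem hS hc hq, Nat.cast_zero, sub_zero]
    have hK : allK G.src G.tgt A.dir ((G.toModel.L : ℝ) ^ A.k) A.Kb S c A.K q = A.Kb q := by simp [allK, hq]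
    rw [hK]
    exact (A.Kb_le q hsite.1 hsite.2.1).mono hC1
  · rw [if_neg hq, add_zero, nHit_eq_codes G ((sites_isSiteSet G).mono hS) hc q]
    unfold allK
    rw [if_neg hq]
    have hpx : xcode G.src S c q = 2 → G.diffOn (G.src q) q = 0 := fun h => A.diffOn_src_eq_zero_of_xcode hS h
    have hpy : ycode G.src G.tgt S c q = 2 → G.diffOn (G.tgt q) q = 0 := fun h => A.diffOn_tgt_eq_zero_of_ycode hS h
    by_cases hloop : G.src q = G.tgt q
    · have hexp : ((if xcode G.src S c q = 2 then 1 else 0)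
          + (if G.src q ≠ G.tgt q ∧ ycode G.src G.tgt S c q = 2 then 1 else 0) : ℕ) = nd (xcode G.src S c q) := by
        rw [if_neg (show ¬ (G.src q ≠ G.tgt q ∧ ycode G.src G.tgt S c q = 2) from fun h => h.1 hloop), add_zero]
        rfl
      rw [if_pos hloop, hexp]
      have hpy' : xcode G.src S c q = 2 → G.diffOn (G.tgt q) q = 0 := fun h => hloop ▸ hpx h
      exact (A.budgetC q).apCode_bound_loop hCq (IBPAmp.xcode_le_two q) hpx hpy' _
    · rw [if_neg hloop]
      have h := (A.budgetC q).apCode_bound hCq (IBPAmp.xcode_le_two (G := G) (S := S) (c := c) q)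
        (IBPAmp.ycode_le_two (G := G) (S := S) (c := c) q) hpx hpy (A.dir (G.src q)) (A.dir (G.tgt q))
      simp only [nd, ne_eq, hloop, not_false_eq_true, true_and] at h ⊢
      exact h

/-- **The vertex functions of the term `c` obey the vertex bound** (`× cD` where differentiated).
[cite: Balaban1983Higgs3, (2.9) p.425] -/
theorem term_u_le (A : IBPAmp₁ G) (hS : S ⊆ sites G) (v : V) (x : Fin G.toModel.d → ℕ) :
    |allU G.src A.dir ((G.toModel.L : ℝ) ^ A.k) S c A.u v x|
      ≤ A.eRun ^ A.dv v * A.lamRun ^ A.ds v * A.NPhi v * A.NAc S c v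
        * (((G.toModel.L : ℝ) ^ A.k)⁻¹) ^ (moveCounts G S c).toModel.e v := by
  have he : (moveCounts G S c).toModel.e v = G.toModel.e v := rfl
  rw [he]
  unfold allU NAc
  by_cases h1 : ∃ l ∈ S, G.src l = v
  · rw [if_pos h1]
    obtain ⟨l, hl, hlv⟩ := h1
    have hsite := mem_sites.1 (hS hl)
    by_cases h2 : ∃ l ∈ S, G.src l = v ∧ c l = none
    · rw [if_pos h2, if_pos h2, abs_neg, ← hlv]
      calc |bdiffQ ((G.toModel.L : ℝ) ^ A.k) (A.dir (G.src l)) (A.u (G.src l)) x|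
          ≤ A.cD * (A.eRun ^ A.dv (G.src l) * A.lamRun ^ A.ds (G.src l) * A.NPhi (G.src l) * A.NA (G.src l)
              * (((G.toModel.L : ℝ) ^ A.k)⁻¹) ^ G.toModel.e (G.src l)) := A.du_le l hsite.1 hsite.2.1 x
        _ = _ := by ring
    · rw [if_neg h2, if_neg h2, abs_neg]
      exact A.u_le v _
  · have h2 : ¬ ∃ l ∈ S, G.src l = v ∧ c l = none := fun ⟨l, hl, hv, _⟩ => h1 ⟨l, hl, hv⟩
    rw [if_neg h1, if_neg h2]
    exact A.u_le v x

/-- **The term `G′∗_c` as an amplitude of the class `Amp` over the moved count datum.** [cite: Balaban1983Higgs3, (2.9) p.425] -/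
noncomputable def term (A : IBPAmp₁ G) (hS : S ⊆ sites G) (hc : c ∈ choices G.src G.tgt S) : Amp (moveCounts G S c).toModel where
  k := A.k
  box := A.box
  u := allU G.src A.dir ((G.toModel.L : ℝ) ^ A.k) S c A.u
  K := allK G.src G.tgt A.dir ((G.toModel.L : ℝ) ^ A.k) A.Kb S c A.K
  C := fun q => A.C q * (1 + Esh G.toModel) ^ 2
  eRun := A.eRun
  lamRun := A.lamRun
  dv := A.dv
  ds := A.ds
  NPhi := A.NPhi
  NA := A.NAc S c
  C_nonneg := fun q => mul_nonneg (A.C_nonneg q) (sq_nonneg _)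
  eRun_nonneg := A.eRun_nonneg
  lamRun_nonneg := A.lamRun_nonneg
  NPhi_nonneg := A.NPhi_nonneg
  NA_nonneg := fun v => by
    unfold NAc
    split_ifs
    · exact mul_nonneg (le_trans zero_le_one A.one_le_cD) (A.NA_nonneg v)
    · exact A.NA_nonneg v
  e_nonneg := A.e_nonneg
  conn := A.conn
  u_le := A.term_u_le hS
  K_le := fun q => A.term_K_le hS hc q

/-- The amplitude of the term at `j` is the raw sum of its closed-form data. [cite: Balaban1983Higgs3, (2.9) p.425] -/
theorem term_E (A : IBPAmp₁ G) (hS : S ⊆ sites G) (hc : c ∈ choices G.src G.tgt S) (j : Fin m → ℕ) : (A.term hS hc).E j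
    = rawE G.toModel.L G.toModel.d A.k G.src G.tgt A.box (allU G.src A.dir ((G.toModel.L : ℝ) ^ A.k) S c A.u)
        (allK G.src G.tgt A.dir ((G.toModel.L : ℝ) ^ A.k) A.Kb S c A.K) j := rfl

/-- **`E(G′(j)) = Σ_c E(G′∗_c(j))`** with each term an amplitude of the class `Amp` over its moved count datum.
[cite: Balaban1983Higgs3, (2.9) p.425] -/
theorem E_eq_sum_terms (A : IBPAmp₁ G) (hS : S ⊆ sites G) (j : Fin m → ℕ) :
    A.E j = ∑ c ∈ (choices G.src G.tgt S).attach, (A.term hS c.2).E j := by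
  have hS1 := fun l (hl : l ∈ S) => mem_sites.1 (hS hl)
  have hsum : ∑ c ∈ (choices G.src G.tgt S).attach, (A.term hS c.2).E j
      = ∑ c ∈ choices G.src G.tgt S, rawE G.toModel.L G.toModel.d A.k G.src G.tgt A.box
          (allU G.src A.dir ((G.toModel.L : ℝ) ^ A.k) S c A.u)
          (allK G.src G.tgt A.dir ((G.toModel.L : ℝ) ^ A.k) A.Kb S c A.K) j :=
    sum_attach (choices G.src G.tgt S) fun c => rawE G.toModel.L G.toModel.d A.k G.src G.tgt A.box
      (allU G.src A.dir ((G.toModel.L : ℝ) ^ A.k) S c A.u) (allK G.src G.tgt A.dir ((G.toModel.L : ℝ) ^ A.k) A.Kb S c A.K) j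
  rw [hsum]
  exact A.E_allSites A.dir A.Kb j S ((sites_isSiteSet G).mono hS)
    (fun l hl x y => A.K_eq l (hS1 l hl).1 (hS1 l hl).2.1 (j l) x y) (fun l hl => A.u_face l (hS1 l hl).1 (hS1 l hl).2.1)

/-! ## The prefactor of a term -/

/-- `Π_v NAc v ≤ cD^m · Π_v NA v`. [cite: Balaban1983Higgs3, (2.9) p.425] -/
theorem prod_NAc_le (A : IBPAmp₁ G) : ∏ v, A.NAc S c v ≤ A.cD ^ m * ∏ v, A.NA v := by
  classical
  have hcD := A.one_le_cD
  have h1 : ∏ v, A.NAc S c v = (∏ v, (if (∃ l ∈ S, G.src l = v ∧ c l = none) then A.cD else 1)) * ∏ v, A.NA v := by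
    rw [← prod_mul_distrib]
    refine prod_congr rfl fun v _ => ?_
    unfold NAc
    split_ifs <;> simp
  rw [h1, prod_ite, prod_const_one, mul_one, prod_const]
  refine mul_le_mul_of_nonneg_right ?_ (prod_nonneg fun v _ => A.NA_nonneg v)
  exact pow_le_pow_right₀ hcD IBPAmp.card_derived_le

/-- **The prefactor of a term is at most `cD^m` times the prefactor of the amplitude.** [cite: Balaban1983Higgs3, (1.33) p.420] -/
theorem term_pref_le (A : IBPAmp₁ G) (hS : S ⊆ sites G) (hc : c ∈ choices G.src G.tgt S) :
    (A.term hS hc).pref ≤ A.cD ^ m * A.toAmp.pref := by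
  have hk : (A.term hS hc).k = A.k := rfl
  have hbox : (A.term hS hc).box = A.box := rfl
  have hδ : (moveCounts G S c).δ₁ = G.δ₁ := rfl
  have hL : (moveCounts G S c).L = G.L := rfl
  show (A.term hS hc).eRun ^ (∑ v, (A.term hS hc).dv v) * (A.term hS hc).lamRun ^ (∑ v, (A.term hS hc).ds v)
      * Real.exp (-((moveCounts G S c).δ₁ / 2 * boxTreeLen (moveCounts G S c).L (A.term hS hc).k (A.term hS hc).box))
      * (∏ v, (A.term hS hc).NPhi v) * ∏ v, (A.term hS hc).NA v
    ≤ A.cD ^ m * (A.eRun ^ (∑ v, A.dv v) * A.lamRun ^ (∑ v, A.ds v)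
      * Real.exp (-(G.δ₁ / 2 * boxTreeLen G.L A.k A.box)) * (∏ v, A.NPhi v) * ∏ v, A.NA v)
  rw [hk, hbox, hδ, hL]
  have hmain := A.prod_NAc_le (S := S) (c := c)
  have h0 : 0 ≤ A.eRun ^ (∑ v, A.dv v) * A.lamRun ^ (∑ v, A.ds v) * Real.exp (-(G.δ₁ / 2 * boxTreeLen G.L A.k A.box))
      * (∏ v, A.NPhi v) := by
    have := A.eRun_nonneg
    have := A.lamRun_nonneg
    have : 0 ≤ ∏ v, A.NPhi v := prod_nonneg fun v _ => A.NPhi_nonneg v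
    positivity
  calc A.eRun ^ (∑ v, A.dv v) * A.lamRun ^ (∑ v, A.ds v) * Real.exp (-(G.δ₁ / 2 * boxTreeLen G.L A.k A.box))
        * (∏ v, A.NPhi v) * ∏ v, A.NAc S c v
      ≤ A.eRun ^ (∑ v, A.dv v) * A.lamRun ^ (∑ v, A.ds v) * Real.exp (-(G.δ₁ / 2 * boxTreeLen G.L A.k A.box))
        * (∏ v, A.NPhi v) * (A.cD ^ m * ∏ v, A.NA v) := mul_le_mul_of_nonneg_left hmain h0
    _ = _ := by ring

/-- The product of the term's kernel constants. [cite: Balaban1983Higgs3, (2.13) p.426] -/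
theorem term_prod_C (A : IBPAmp₁ G) (hS : S ⊆ sites G) (hc : c ∈ choices G.src G.tgt S) :
    ∏ q, (A.term hS hc).C q = (∏ q, A.C q) * ((1 + Esh G.toModel) ^ 2) ^ m := by
  show ∏ q, A.C q * (1 + Esh G.toModel) ^ 2 = _
  rw [prod_mul_distrib, prod_const, card_univ, Fintype.card_fin]

end IBPAmp₁

end Ready

end Literature.MathematicalPhysics.QuantumFieldTheory.Balaban1983to89.B3Ineq213
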